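import Summits.HodgeConjecture.HodgeCM.PerL34.QuotientInStages_1

/-! PORT of `HodgeCM/PerL34/QuotientInStages.lean` (HodgeCMPerL run 82) — part 2: continuation of `Summits.HodgeConjecture.HodgeCM.PerL34.QuotientInStages_1` (split at a top-level declaration boundary by port_pkg.py; scope re-opened below; declarations unchanged). -/

-- port_pkg: scope re-opened for this part (file-level context, then the namespace/section stack open at the cut)
noncomputable section
open scoped Pointwise
open MulAction Topology
namespace HodgeCM.PerL34.Godement
open HodgeCM.PerL34.Godement.Stages
open HodgeCM.Adelic HodgeCM.PerL34.AdelicUnitaryFactorisation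
section PerLPieces
variable (L : CMField) {m : ℕ} (H : Matrix (Fin m) (Fin m) L) (C : Subgroup (Uinf L H))
  (K₁ Kf : Subgroup (Ufin L H)) (g : Ufin L H)
/-- (Ported verbatim from the HodgeCMPerL package; no docstring in the source.) -/
private theorem isCompact_conj_smul'' {B : Type*} [Group B] [TopologicalSpace B] [IsTopologicalGroup B]
    (K : Subgroup B) (hK : IsCompact (K : Set B)) (b : B) :
    IsCompact ((MulAut.conj b • K : Subgroup B) : Set B) := by
  have hset : ((MulAut.conj b • K : Subgroup B) : Set B) = (fun x => b * x * b⁻¹) '' (K : Set B) := by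
    rw [Subgroup.coe_pointwise_smul, ← Set.image_smul]
    simp only [MulAut.smul_def, MulAut.conj_apply]
  rw [hset]
  exact hK.image ((continuous_const.mul continuous_id).mul continuous_const)

/-- **The deck group of the piece** `Γ_H(gK₁g⁻¹)\\Y → Γ_H(gK_fg⁻¹)\\Y`, `Y = U(H)(ℝ)/C`: the image of
`Γ_H(gK_fg⁻¹)` in `Perm (Γ_H(gK₁g⁻¹)\\Y)` (normality as an explicit hypothesis, to keep statements light). -/
def pieceDeckGroup
    (hle : congruenceLattice L H (MulAut.conj g • K₁) ≤ congruenceLattice L H (MulAut.conj g • Kf))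
    (hN : ((congruenceLattice L H (MulAut.conj g • K₁)).subgroupOf
      (congruenceLattice L H (MulAut.conj g • Kf))).Normal) :
    Subgroup (Equiv.Perm (orbitRel.Quotient (congruenceLattice L H (MulAut.conj g • K₁)) (Uinf L H ⧸ C))) :=
  (@deckHom _ _ _ _ (congruenceLattice L H (MulAut.conj g • K₁)) (congruenceLattice L H (MulAut.conj g • Kf))
    hle hN).range

variable {hle : congruenceLattice L H (MulAut.conj g • K₁) ≤ congruenceLattice L H (MulAut.conj g • Kf)}
  {hN : ((congruenceLattice L H (MulAut.conj g • K₁)).subgroupOf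
    (congruenceLattice L H (MulAut.conj g • Kf))).Normal}

/-- (Ported verbatim from the HodgeCMPerL package; no docstring in the source.) -/
theorem pieceDeckGroup_eq :
    pieceDeckGroup L H C K₁ Kf g hle hN =
      (@deckHom _ (Uinf L H ⧸ C) _ _ (congruenceLattice L H (MulAut.conj g • K₁))
        (congruenceLattice L H (MulAut.conj g • Kf)) hle hN).range := rfl

/-- (Ported verbatim from the HodgeCMPerL package; no docstring in the source.) -/
theorem finite_pieceDeckGroup
    (hFI : ((congruenceLattice L H (MulAut.conj g • K₁)).subgroupOf
      (congruenceLattice L H (MulAut.conj g • Kf))).FiniteIndex) :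
    Finite (pieceDeckGroup L H C K₁ Kf g hle hN) := by
  haveI := hN
  exact finite_range_deckHom _ _ hle

/-- (Ported verbatim from the HodgeCMPerL package; no docstring in the source.) -/
theorem natCard_pieceDeckGroup_dvd :
    Nat.card (pieceDeckGroup L H C K₁ Kf g hle hN) ∣
      (congruenceLattice L H (MulAut.conj g • K₁)).relIndex (congruenceLattice L H (MulAut.conj g • Kf)) := by
  haveI := hN
  exact natCard_range_deckHom_dvd _ _ hle

/-- **`(Γ_H(gK₁g⁻¹)\\Y)/D_g ≃ₜ Γ_H(gK_fg⁻¹)\\Y`**, `Y = U(H)(ℝ)/C`. -/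
def pieceStagesHomeomorph :
    orbitRel.Quotient (pieceDeckGroup L H C K₁ Kf g hle hN)
        (orbitRel.Quotient (congruenceLattice L H (MulAut.conj g • K₁)) (Uinf L H ⧸ C)) ≃ₜ
      orbitRel.Quotient (congruenceLattice L H (MulAut.conj g • Kf)) (Uinf L H ⧸ C) :=
  @stagesHomeomorph _ _ _ _ _ (congruenceLattice L H (MulAut.conj g • K₁))
    (congruenceLattice L H (MulAut.conj g • Kf)) hle hN

/-- The deck group acts freely as soon as `Γ_H(gK_fg⁻¹)` is torsion-free (`C` compact, `gK_fg⁻¹` compact). -/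
theorem stabilizer_pieceDeckGroup_eq_bot (hC : IsCompact (C : Set (Uinf L H)))
    [DiscreteTopology (congruenceLattice L H (MulAut.conj g • Kf))]
    (htf : ∀ γ ∈ congruenceLattice L H (MulAut.conj g • Kf), IsOfFinOrder γ → γ = 1)
    (q : orbitRel.Quotient (congruenceLattice L H (MulAut.conj g • K₁)) (Uinf L H ⧸ C)) :
    MulAction.stabilizer (pieceDeckGroup L H C K₁ Kf g hle hN) q = ⊥ := by
  haveI := hN
  exact stabilizer_deck_eq_bot _ _ hle (fun y => stabilizer_inf_eq_bot_of_torsionFree _ htf C hC y) q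

/-- … and then `|D_g| = [Γ_H(gK_fg⁻¹) : Γ_H(gK₁g⁻¹)]`. -/
theorem natCard_pieceDeckGroup_eq (hC : IsCompact (C : Set (Uinf L H)))
    [DiscreteTopology (congruenceLattice L H (MulAut.conj g • Kf))]
    (htf : ∀ γ ∈ congruenceLattice L H (MulAut.conj g • Kf), IsOfFinOrder γ → γ = 1) :
    Nat.card (pieceDeckGroup L H C K₁ Kf g hle hN) =
      (congruenceLattice L H (MulAut.conj g • K₁)).relIndex (congruenceLattice L H (MulAut.conj g • Kf)) := by
  haveI := hN
  exact natCard_range_deckHom_eq _ _ hle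
    (stabilizer_inf_eq_bot_of_torsionFree _ htf C hC (QuotientGroup.mk 1 : Uinf L H ⧸ C))

/-- **PerL v5 l. 75 for ONE piece, as a named record.**  For `g ∈ U(H)(𝔸_f)`, `Γ = Γ_H(gK_fg⁻¹)`,
`Γ₁ = Γ_H(gK₁g⁻¹)` acting on `Y = U(H)(ℝ)/C`: `Γ₁ ⊴ Γ`; `Γ₁` acts freely on `Y`; the deck group `D_g` of
`Γ₁\\Y → Γ\\Y` is finite of order dividing `[K_f : K₁]`; `(Γ₁\\Y)/D_g ≃ₜ Γ\\Y`; and if `Γ` is torsion-free then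
`D_g` acts freely on `Γ₁\\Y` and `|D_g| = [Γ : Γ₁]`. -/
structure PieceQuotientInStages : Prop where
  /-- `Γ_H(gK₁g⁻¹) ≤ Γ_H(gK_fg⁻¹)`. -/
  le : congruenceLattice L H (MulAut.conj g • K₁) ≤ congruenceLattice L H (MulAut.conj g • Kf)
  /-- … and it is a normal subgroup. -/
  normal : ((congruenceLattice L H (MulAut.conj g • K₁)).subgroupOf
    (congruenceLattice L H (MulAut.conj g • Kf))).Normal
  /-- `Γ_H(gK₁g⁻¹)` acts freely on `U(H)(ℝ)/C`. -/
  free : ∀ y : Uinf L H ⧸ C,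
    MulAction.stabilizer (Uinf L H) y ⊓ congruenceLattice L H (MulAut.conj g • K₁) = ⊥
  /-- The deck group is finite … -/
  finite_deck : Finite (pieceDeckGroup L H C K₁ Kf g le normal)
  /-- … of order dividing `[K_f : K₁]`. -/
  card_deck_dvd : Nat.card (pieceDeckGroup L H C K₁ Kf g le normal) ∣ K₁.relIndex Kf
  /-- **`(Γ_H(gK₁g⁻¹)\\Y)/D_g ≃ₜ Γ_H(gK_fg⁻¹)\\Y`.** -/
  stages : Nonempty (orbitRel.Quotient (pieceDeckGroup L H C K₁ Kf g le normal)
      (orbitRel.Quotient (congruenceLattice L H (MulAut.conj g • K₁)) (Uinf L H ⧸ C)) ≃ₜ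
    orbitRel.Quotient (congruenceLattice L H (MulAut.conj g • Kf)) (Uinf L H ⧸ C))
  /-- If `Γ_H(gK_fg⁻¹)` is torsion-free the deck group acts freely … -/
  free_deck : (∀ γ ∈ congruenceLattice L H (MulAut.conj g • Kf), IsOfFinOrder γ → γ = 1) →
    ∀ q : orbitRel.Quotient (congruenceLattice L H (MulAut.conj g • K₁)) (Uinf L H ⧸ C),
      MulAction.stabilizer (pieceDeckGroup L H C K₁ Kf g le normal) q = ⊥
  /-- … and has order exactly `[Γ_H(gK_fg⁻¹) : Γ_H(gK₁g⁻¹)]`. -/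
  card_deck_eq : (∀ γ ∈ congruenceLattice L H (MulAut.conj g • Kf), IsOfFinOrder γ → γ = 1) →
    Nat.card (pieceDeckGroup L H C K₁ Kf g le normal) =
      (congruenceLattice L H (MulAut.conj g • K₁)).relIndex (congruenceLattice L H (MulAut.conj g • Kf))

/-- Constructor of the record from the tower data of `CongruenceLatticeTower` (#9) for a torsion-free
`Γ_H(gK₁g⁻¹)`, `C` compact. -/
theorem PieceQuotientInStages.of_tower (hC : IsCompact (C : Set (Uinf L H)))
    [DiscreteTopology (congruenceLattice L H (MulAut.conj g • K₁))]
    [DiscreteTopology (congruenceLattice L H (MulAut.conj g • Kf))]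
    (hle : congruenceLattice L H (MulAut.conj g • K₁) ≤ congruenceLattice L H (MulAut.conj g • Kf))
    (hN : ((congruenceLattice L H (MulAut.conj g • K₁)).subgroupOf
      (congruenceLattice L H (MulAut.conj g • Kf))).Normal)
    (hFI : ((congruenceLattice L H (MulAut.conj g • K₁)).subgroupOf
      (congruenceLattice L H (MulAut.conj g • Kf))).FiniteIndex)
    (hdvd : (congruenceLattice L H (MulAut.conj g • K₁)).relIndex (congruenceLattice L H (MulAut.conj g • Kf)) ∣
      K₁.relIndex Kf)
    (htf : ∀ γ ∈ congruenceLattice L H (MulAut.conj g • K₁), IsOfFinOrder γ → γ = 1) :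
    PieceQuotientInStages L H C K₁ Kf g where
  le := hle
  normal := hN
  free y := stabilizer_inf_eq_bot_of_torsionFree _ htf C hC y
  finite_deck := finite_pieceDeckGroup L H C K₁ Kf g hFI
  card_deck_dvd := (natCard_pieceDeckGroup_dvd L H C K₁ Kf g).trans hdvd
  stages := ⟨pieceStagesHomeomorph L H C K₁ Kf g⟩
  free_deck htfΓ := stabilizer_pieceDeckGroup_eq_bot L H C K₁ Kf g hC htfΓ
  card_deck_eq htfΓ := natCard_pieceDeckGroup_eq L H C K₁ Kf g hC htfΓ

end PerLPieces

end HodgeCM.PerL34.Godement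

namespace HodgeCM.HermSpace3

open HodgeCM.PerL34.Godement HodgeCM.PerL34.Godement.Stages
open HodgeCM.Adelic HodgeCM.PerL34.AdelicUnitaryFactorisation

variable (L : CMField) {ι₁ : L →+* ℂ} (V : HermSpace3 L ι₁)

/-- **PerL v5 ll. 74–75 (KERNEL, analytic pieces, group-action level).**  For `G_U`, a compact subgroup
`C ≤ G_U(ℝ)` and a compact open level `K_f` there is ONE compact open `K₁ ≤ K_f ∩ K_H(3)`, normal of finite
index in `K_f`, such that for EVERY `g ∈ G_U(𝔸_{L₀,f})` the piece record `PieceQuotientInStages` holds: with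
`Γ = Γ_H(gK_fg⁻¹)`, `Γ₁ = Γ_H(gK₁g⁻¹)` acting on `Y = G_U(ℝ)/C` — `Γ₁ ⊴ Γ`; `Γ₁` acts FREELY on `Y`; the deck
group `D_g ≤ Perm (Γ₁\\Y)` of `Γ₁\\Y → Γ\\Y` is FINITE of order dividing `[K_f : K₁]`; **`(Γ₁\\Y)/D_g ≃ₜ Γ\\Y`**;
and if `Γ` is itself torsion-free, `D_g` acts freely on `Γ₁\\Y` with `|D_g| = [Γ : Γ₁]`.  This is the
group-action content of "P_{K_f} is the quotient of P_{K₁} by the finite group K_f/K₁" (PerL v5 l. 75). -/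
theorem exists_pieces_quotient_in_stages (C : Subgroup (Uinf L V.Hm)) (hC : IsCompact (C : Set (Uinf L V.Hm)))
    (Kf : Subgroup (Ufin L V.Hm)) (hKo : IsOpen (Kf : Set (Ufin L V.Hm)))
    (hKc : IsCompact (Kf : Set (Ufin L V.Hm))) :
    ∃ K₁ : Subgroup (Ufin L V.Hm), K₁ ≤ Kf ∧ K₁ ≤ levelUfin L V.Hm 3 ∧ IsOpen (K₁ : Set (Ufin L V.Hm)) ∧
      IsCompact (K₁ : Set (Ufin L V.Hm)) ∧ (K₁.subgroupOf Kf).Normal ∧ (K₁.subgroupOf Kf).FiniteIndex ∧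
      ∀ g : Ufin L V.Hm, PieceQuotientInStages L V.Hm C K₁ Kf g := by
  obtain ⟨K₁, h1f, h13, hK1o, hK1c, hN, hFI, hg⟩ :=
    HodgeCM.PerL34.Godement.exists_torsionFree_normal_tower L V.Hm Kf hKo hKc
  refine ⟨K₁, h1f, h13, hK1o, hK1c, hN, hFI, fun g => ?_⟩
  obtain ⟨hle, hNg, hFIg, hdvd, htf⟩ := hg g
  haveI : DiscreteTopology (congruenceLattice L V.Hm (MulAut.conj g • K₁)) :=
    HodgeCM.HermSpace3.discreteTopology_congruenceLattice L V _
      (isCompact_conj_smul'' K₁ hK1c g)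
  haveI : DiscreteTopology (congruenceLattice L V.Hm (MulAut.conj g • Kf)) :=
    HodgeCM.HermSpace3.discreteTopology_congruenceLattice L V _
      (isCompact_conj_smul'' Kf hKc g)
  exact PieceQuotientInStages.of_tower L V.Hm C K₁ Kf g hC hle hNg hFIg hdvd htf

end HodgeCM.HermSpace3

end

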